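import Summits.CriticalPhenomena.PercolationContinuityZ3.Theses.PercSieveRigidity
import Summits.CriticalPhenomena.PercolationContinuityZ3.Theorems.PercNearOneGluingNoHeavyLowerTailCSHTheoremOne
import Summits.CriticalPhenomena.PercolationContinuityZ3.Theorems.PercPotemkinWeaverBernoulliSoftPortrait
import HarnessLib

/-!
# `PercSieveRigidity.BernoulliSoftPortrait` (stmt-CriticalPhenomena-11220) — SETTLED after continuity

Item `stmt-CriticalPhenomena-11220` of route `CriticalPhenomena/PercSieveRigidity` (support): Bernoulli(p_c) on ℤ³ satisfies the soft portrait of route PercSieveRigidity (lattice support, insertion/deletion tolerance, ergodic shifts, automorphism invariance, FKG, finite half-space clusters).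

Projection of the nine-clause portrait proved for route PercPotemkinWeaver (`PercPotemkinWeaverBernoulliSoftPortrait.bernoulliSoftPortrait_proof`, item 4883: Literature facts + deletion tolerance + p205010 for the half-space clusters).

builds on p205010 (kernel theorem, internal audit signed; external expert review pending) — USED (`CSH.percolationContinuityZ3_holds`).  RSW3 lane, lead gen 28 (prover-prim-rsw3-lead-g28-0):
'after continuity — the ledger harvest'.
References: G. Kozma, N. Nitzan (2024), Thm. 6 / Conj. 3 [KozmaNitzan2024]; G. Grimmett, *Percolation* (1999), §8 [GrimmettPercolation1999].
-/

noncomputable section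

namespace Summit.CriticalPhenomena.PercolationContinuityZ3.Theorems

namespace PercSieveRigidityBernoulliSoftPortrait

open MeasureTheory Literature.Probability.Percolation Literature.Probability.LatticeModels

/-- **`PercSieveRigidity.BernoulliSoftPortrait` (stmt-CriticalPhenomena-11220), settled.**  clauses 1,4,5,6,7,8,9 of the PercPotemkinWeaver portrait (item 4883).
[cite: KozmaNitzan2024, Thm. 6 with Conj. 3 (p. 15)] -/
theorem bernoulliSoftPortrait_proof : Summit.CriticalPhenomena.PercolationContinuityZ3.Theses.PercSieveRigidity.BernoulliSoftPortrait := by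
  unfold Summit.CriticalPhenomena.PercolationContinuityZ3.Theses.PercSieveRigidity.BernoulliSoftPortrait
  intro μ hμ
  subst hμ
  obtain ⟨h1, -, -, h4, h5, h6, h7, h8, h9⟩ := PercPotemkinWeaverBernoulliSoftPortrait.bernoulliSoftPortrait_proof
  exact ⟨h1, h4, h5, h6, h7, h8, h9⟩

end PercSieveRigidityBernoulliSoftPortrait

end Summit.CriticalPhenomena.PercolationContinuityZ3.Theorems

end
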